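import Literature.NumberTheory.QuadraticFields.RedeiReichardtFourRank
import HarnessLib

/-!
# Rédei–Reichardt certificates, now unconditional: `4`-ranks of `Cl(ℚ(√-n))` by `decide`

Topic `NumberTheory/QuadraticFields`, namespace `Literature.NumberTheory.QuadraticFields.RedeiReichardt`.
Theorem-only file (no definition, no named fact).  With the Rédei–Reichardt theorem PROVED
(`redeiReichardt_fourTwoCard_classGroup_holds`, `RedeiReichardtFourRank.lean`), the "doors" of
`RedeiMatrixFourRank.lean` §4 (which took the named fact as the hypothesis `h`) become unconditional:
the `4`-rank data `#(Cl_K² ∩ Cl_K[2])` (`Tian2014.fourTwoCard`), "no ideal class of order `4`"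
(`LiLiuTian2024.NoIdealClassOfOrderFour`) and Tian's condition (1.1) (`Tian2014.Condition11`) of the
imaginary quadratic field `ℚ(√-n)` follow from a `decide`-able kernel count of Li–Ma's Rédei matrix.

* `card_ker_redeiMatrix_eq`, `fourTwoCard_eq_of_card_ker'`, `noIdealClassOfOrderFour_of_card_ker'`,
  `fourTwoCard_eq_two_of_card_ker'`, `condition11_of_card_ker'` — §4 of `RedeiMatrixFourRank.lean`
  without the hypothesis `h`;
* the printed examples of §5, now theorems about class groups: `ℚ(√-33)` and `ℚ(√-85)` have no ideal
  class of order `4` (Li–Ma Ex. 0.5; a composite member of Li–Liu–Tian's family), `Condition11 7 K`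
  for `K = ℚ(√-14)` (Tian 2014 (1.1)), `fourTwoCard (Cl ℚ(√-17)) = 2` (Wang 2016, `h₄(17) = 1`).

## References

* Y. Li, L. Ma, Acta Arith. 134 (2008), Thm. 0.4, Example 0.5. [LiMa2008]
* Y. Tian, *Congruent numbers and Heegner points*, Cambridge J. Math. 2 (2014), Thm. 1.3 (1.1). [Tian2014]
* Y. Li, Y. Liu, Y. Tian, Sci. Sinica Math. 54 (2024), Thm. 1.2. [LiLiuTian2024]
* Z. Wang, Sci. China Math. 59 (2016), Thm. 3. [Wang2016CongruentSha]
-/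

noncomputable section

open NumberField Matrix

namespace Literature.NumberTheory.QuadraticFields.RedeiReichardt

open Literature.NumberTheory.EllipticCurves.Tian2014 (IsQuadraticFieldOfSqrt fourTwoCard Condition11)
open Literature.NumberTheory.EllipticCurves.LiLiuTian2024 (NoIdealClassOfOrderFour)

variable {t n : ℕ} {p : Fin t → ℕ}

/-- **`#{v : RM(D) v = 0} = 2 · #(Cl_K² ∩ Cl_K[2])`**, unconditionally. [cite: LiMa2008, Thm. 0.4] -/
theorem card_ker_redeiMatrix_eq (hp : ∀ i, (p i).Prime) (hinj : Function.Injective p)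
    (hprod : ∏ i, p i = if n % 4 = 1 then 2 * n else n)
    (K : Type) [Field K] [NumberField K] (hK : IsQuadraticFieldOfSqrt K (-(n : ℤ))) :
    Fintype.card {v : Fin t → ZMod 2 // redeiMatrix n p *ᵥ v = 0} = 2 * fourTwoCard (ClassGroup (𝓞 K)) :=
  card_ker_redeiMatrix_eq_two_mul_fourTwoCard redeiReichardt_fourTwoCard_classGroup_holds hp hinj hprod K hK

/-- **`#ker RM(D) = 2^{e+1} ⟹ #(Cl_K² ∩ Cl_K[2]) = 2^e`** (`r₄ = e`), unconditionally. [cite: LiMa2008, Thm. 0.4] -/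
theorem fourTwoCard_eq_of_card_ker' (hp : ∀ i, (p i).Prime) (hinj : Function.Injective p)
    (hprod : ∏ i, p i = if n % 4 = 1 then 2 * n else n) {e : ℕ}
    (hker : Fintype.card {v : Fin t → ZMod 2 // redeiMatrix n p *ᵥ v = 0} = 2 ^ (e + 1))
    (K : Type) [Field K] [NumberField K] (hK : IsQuadraticFieldOfSqrt K (-(n : ℤ))) :
    fourTwoCard (ClassGroup (𝓞 K)) = 2 ^ e :=
  fourTwoCard_eq_of_card_ker redeiReichardt_fourTwoCard_classGroup_holds hp hinj hprod hker K hK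

/-- **`#ker RM(D) = 2 ⟹ ℚ(√-n)` has no ideal class of order `4`**, unconditionally (the hypothesis of
Li–Liu–Tian 2024 Thm. 1.2 as a decidable certificate). [cite: LiLiuTian2024, Thm. 1.2 (hypothesis)] [cite: LiMa2008, Thm. 0.4] -/
theorem noIdealClassOfOrderFour_of_card_ker' (hp : ∀ i, (p i).Prime) (hinj : Function.Injective p)
    (hprod : ∏ i, p i = if n % 4 = 1 then 2 * n else n)
    (hker : Fintype.card {v : Fin t → ZMod 2 // redeiMatrix n p *ᵥ v = 0} = 2) :
    NoIdealClassOfOrderFour (-(n : ℤ)) :=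
  noIdealClassOfOrderFour_of_card_ker redeiReichardt_fourTwoCard_classGroup_holds hp hinj hprod hker

/-- **`#ker RM(D) = 4 ⟹ #(Cl_K² ∩ Cl_K[2]) = 2`** (`h₄(n) = 1`), unconditionally (the class-group binder
of Wang 2016 Thm. 3). [cite: Wang2016CongruentSha, Thm. 3 (hypothesis h₄(n) = 1)] [cite: LiMa2008, Thm. 0.4] -/
theorem fourTwoCard_eq_two_of_card_ker' (hp : ∀ i, (p i).Prime) (hinj : Function.Injective p)
    (hprod : ∏ i, p i = if n % 4 = 1 then 2 * n else n)
    (hker : Fintype.card {v : Fin t → ZMod 2 // redeiMatrix n p *ᵥ v = 0} = 4)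
    (K : Type) [Field K] [NumberField K] (hK : IsQuadraticFieldOfSqrt K (-(n : ℤ))) :
    fourTwoCard (ClassGroup (𝓞 K)) = 2 :=
  fourTwoCard_eq_two_of_card_ker redeiReichardt_fourTwoCard_classGroup_holds hp hinj hprod hker K hK

/-- **Tian 2014 (1.1) for `ℚ(√-2n)` from the kernel count**, unconditionally. [cite: Tian2014, Thm. 1.3 (1.1)] [cite: LiMa2008, Thm. 0.4] -/
theorem condition11_of_card_ker' (hp : ∀ i, (p i).Prime) (hinj : Function.Injective p)
    (hprod : ∏ i, p i = 2 * n)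
    (hker : Fintype.card {v : Fin t → ZMod 2 // redeiMatrix (2 * n) p *ᵥ v = 0} =
      if n % 8 = 3 ∨ n % 8 = 5 then 2 else 4)
    (K : Type) [Field K] [NumberField K] (hK : IsQuadraticFieldOfSqrt K (-(2 * n : ℤ))) :
    Condition11 n K :=
  condition11_of_card_ker redeiReichardt_fourTwoCard_classGroup_holds hp hinj hprod hker K hK

/-! ### The printed examples, as theorems about class groups -/

/-- **Li–Ma Example 0.5**: `ℚ(√-33)` (`Cl ≅ (ℤ/2)²`) has no ideal class of order `4`.
[cite: LiMa2008, Example 0.5 (p. 280)] -/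
theorem noIdealClassOfOrderFour_neg33_holds : NoIdealClassOfOrderFour (-33) :=
  noIdealClassOfOrderFour_neg33 redeiReichardt_fourTwoCard_classGroup_holds

/-- `ℚ(√-85)` (class number `4`, `85 = 5·17 ≡ 5 (mod 8)`, a composite member of Li–Liu–Tian's family)
has no ideal class of order `4`. [cite: LiLiuTian2024, Thm. 1.2 (hypothesis)] -/
theorem noIdealClassOfOrderFour_neg85_holds : NoIdealClassOfOrderFour (-85) :=
  noIdealClassOfOrderFour_neg85 redeiReichardt_fourTwoCard_classGroup_holds

/-- **Tian 2014 (1.1) at `n = 7`**: `Condition11 7 K` for `K = ℚ(√-14)` (`Cl ≅ ℤ/4`).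
[cite: Tian2014, Thm. 1.3 (1.1)] -/
theorem condition11_seven_holds (K : Type) [Field K] [NumberField K]
    (hK : IsQuadraticFieldOfSqrt K (-(2 * 7 : ℤ))) : Condition11 7 K :=
  condition11_seven redeiReichardt_fourTwoCard_classGroup_holds K hK

/-- **Wang 2016, `h₄(17) = 1`**: `#(Cl² ∩ Cl[2]) = 2` for `K = ℚ(√-17)` (`Cl ≅ ℤ/4`).
[cite: Wang2016CongruentSha, Thm. 3 (hypothesis h₄(n) = 1)] -/
theorem fourTwoCard_eq_two_seventeen_holds (K : Type) [Field K] [NumberField K]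
    (hK : IsQuadraticFieldOfSqrt K (-(17 : ℕ) : ℤ)) : fourTwoCard (ClassGroup (𝓞 K)) = 2 :=
  fourTwoCard_eq_two_seventeen redeiReichardt_fourTwoCard_classGroup_holds K hK

end Literature.NumberTheory.QuadraticFields.RedeiReichardt

end
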